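import Summits.CriticalPhenomena.SAWScalingLimit.Theorems.SAWTotalPositivityCriticalBubbleBoundJoinSurgeryDefs
import Summits.CriticalPhenomena.SAWScalingLimit.Theorems.SAWTotalPositivityCriticalBubbleBoundJoinReplace
import Summits.CriticalPhenomena.SAWScalingLimit.Theorems.SAWTotalPositivityCriticalBubbleBoundDockingEntropyZero

/-!
# Madras' modification, cases `B1` and `C1` (stubs `modify_spec_B1`, `modify_spec_C1` of line
`docking-census-joining`, crux stmt-CriticalPhenomena-7117
`Summit.CriticalPhenomena.SAWScalingLimit.Theses.SAWTotalPositivity.CriticalBubbleBound`)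

The two "output column `Y 0 + 2`" cases of Madras' joining modification `modify E Y` of a polygon
`E` of `ℤ²` at its window `Y` (objects of `…JoinSurgeryDefs`; Hammond, Ann. Probab. 46 (2018),
§4.1): `B1` — `Y` is not a vertex, the corner `q = Y + e₁` is, the cell `Y + (1, 2)` is free; the
corner's vertical edge `{q, q + e₁}` (it IS an edge: `q + e₀` lies in the vertex-free corridor and
`q - e₁ = Y` is not a vertex, so the two polygon edges at `q` point left and up) is replaced by the
nine-edge path `q, Y, (1,0), (1,-1), (2,-1), (2,0), (2,1), (1,1), (1,2), (0,2)` (relative to `Y`);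
`C1` — the mirror image in the row of `Y` (corner `Y - e₁`, free cell `Y + (1, -2)`).

Both are instances of ONE lemma `modify_spec_of_path`: an explicit lattice walk through an
explicit list of relative sites (checked by `decide` to be self-avoiding with the right
combinatorics), whose interior sites are not vertices of `E`, is fed to the landed
edge-replacement lemma `isPolygon_replace_edge`, and the eight bookkeeping conclusions are read
off the list.
Everything here is [folklore] bookkeeping around [cite: Hammond2015SAPJoining, §4.1].
-/

noncomputable section

open SimpleGraph
open Literature.Probability.LatticeModels
open Literature.Probability.RandomPlanarGeometry Literature.Probability.RandomPlanarGeometry.SAW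
open scoped BigOperators ENNReal
open Summit.CriticalPhenomena.SAWScalingLimit.Theorems.CriticalBubbleBound.Negative (e₀)
open Summit.CriticalPhenomena.SAWScalingLimit.Theorems.CriticalBubbleBound.Docking

namespace Summit.CriticalPhenomena.SAWScalingLimit.Theorems.CriticalBubbleBound.Join

/-! ## Relative sites and explicit lattice paths -/

/-- Abscissa of `pt Y d`. [folklore] -/
private theorem pt_apply_zero (Y : Site 2) (d : ℤ × ℤ) : pt Y d 0 = Y 0 + d.1 := by simp [pt]

/-- Ordinate of `pt Y d`. [folklore] -/
private theorem pt_apply_one (Y : Site 2) (d : ℤ × ℤ) : pt Y d 1 = Y 1 + d.2 := by simp [pt]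

/-- Two sites of `ℤ²` are equal iff their two coordinates are. [folklore] -/
private theorem site_eq_iff {p q : Site 2} : p = q ↔ p 0 = q 0 ∧ p 1 = q 1 := by
  constructor
  · rintro rfl; exact ⟨rfl, rfl⟩
  · rintro ⟨h0, h1⟩; funext i; fin_cases i <;> assumption

/-- `pt Y` is injective. [folklore] -/
private theorem pt_injective (Y : Site 2) : Function.Injective (pt Y) := by
  intro d d' h
  obtain ⟨h0, h1⟩ := site_eq_iff.1 h
  rw [pt_apply_zero, pt_apply_zero] at h0
  rw [pt_apply_one, pt_apply_one] at h1
  exact Prod.ext (by omega) (by omega)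

/-- Relative sites with prescribed coordinate differences: `pt Y d' = pt Y d + v`. [folklore] -/
private theorem pt_eq_add {Y : Site 2} (d d' : ℤ × ℤ) {v : Site 2} (h0 : d'.1 = d.1 + v 0)
    (h1 : d'.2 = d.2 + v 1) : pt Y d' = pt Y d + v := by
  rw [site_eq_iff]; simp only [Pi.add_apply, pt_apply_zero, pt_apply_one]; omega

/-- `pt Y (0, 0) = Y`. [folklore] -/
private theorem pt_zero (Y : Site 2) : pt Y (0, 0) = Y := by
  rw [site_eq_iff]; simp only [pt_apply_zero, pt_apply_one]; omega

/-- Every site is `Y` plus its offset from `Y`. [folklore] -/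
private theorem Y_add_offset (Y p : Site 2) : Y + ![p 0 - Y 0, p 1 - Y 1] = p := by
  funext i; fin_cases i <;> simp

/-- A unit step of relative sites (right, left, up or down neighbour; checked by `decide`) is a
lattice edge. [folklore] -/
private theorem adj_pt (Y : Site 2) (d d' : ℤ × ℤ)
    (h : (d'.1 = d.1 + 1 ∧ d'.2 = d.2) ∨ (d.1 = d'.1 + 1 ∧ d'.2 = d.2) ∨
      (d'.1 = d.1 ∧ d'.2 = d.2 + 1) ∨ (d'.1 = d.1 ∧ d.2 = d'.2 + 1) := by decide) :
    (zdGraph 2).Adj (pt Y d) (pt Y d') := by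
  have h4 := e₀_e₁_apply
  rcases h with h | h | h | h
  · rw [pt_eq_add (Y := Y) d d' (v := e₀) (by omega) (by omega)]; exact adj_add_e₀ _
  · rw [pt_eq_add (Y := Y) d' d (v := e₀) (by omega) (by omega)]; exact (adj_add_e₀ _).symm
  · rw [pt_eq_add (Y := Y) d d' (v := e₁) (by omega) (by omega)]; exact adj_add_e₁ _
  · rw [pt_eq_add (Y := Y) d' d (v := e₁) (by omega) (by omega)]; exact (adj_add_e₁ _).symm

/-! ## Vertices of a polygon of `ℤ²` -/

/-- Edges of a polygon are lattice edges. [folklore] -/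
private theorem adj_of_mem_polygon {E : Finset (Sym2 (Site 2))} (hE : IsPolygon (zdGraph 2) E)
    {a b : Site 2} (h : s(a, b) ∈ E) : (zdGraph 2).Adj a b := by
  obtain ⟨u, c, -, rfl⟩ := hE
  exact c.adj_of_mem_edges (List.mem_toFinset.1 h)

/-- A vertex `q` of a polygon lying on the polygon edge `{q, p}` lies on a SECOND polygon edge
`{q, r}`, `r ≠ p`. [folklore] -/
private theorem exists_snd_edge {E : Finset (Sym2 (Site 2))} (hE : IsPolygon (zdGraph 2) E)
    {q p : Site 2} (h : s(q, p) ∈ E) : ∃ r, r ≠ p ∧ (zdGraph 2).Adj q r ∧ s(q, r) ∈ E := by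
  obtain ⟨P, -, hPe, hqp, -, -⟩ := hE.exists_isPath_erase h
  cases P with
  | nil => exact absurd rfl (adj_of_mem_polygon hE h).ne
  | cons hadj P' =>
    rename_i r
    have hqr : s(q, r) ∈ (Walk.cons hadj P').edges := by
      rw [Walk.edges_cons]; exact List.mem_cons_self
    refine ⟨r, fun hrp => hqp (by subst hrp; exact hqr), hadj, ?_⟩
    rw [← List.mem_toFinset, hPe] at hqr
    exact (Finset.mem_erase.1 hqr).2

/-- CORNER LEMMA. If `q` is a vertex of the polygon `E` of `ℤ²` but neither `q + e₀` nor `q - v`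
(`v = ± e₁`) is, then `{q, q + v}` is an edge of `E`: the two polygon edges at `q` point in two
distinct lattice directions, and only "left" and "`v`" are available. [folklore] -/
private theorem mem_of_corner {E : Finset (Sym2 (Site 2))} (hE : IsPolygon (zdGraph 2) E) {q v : Site 2}
    (hv : v = e₁ ∨ v = -e₁) (hq : IsV E q) (h₀ : ¬ IsV E (q + e₀)) (h₁ : ¬ IsV E (q - v)) :
    s(q, q + v) ∈ E := by
  by_contra hcon
  -- every polygon edge at `q` points left
  have key : ∀ x, (zdGraph 2).Adj q x → s(q, x) ∈ E → x = q - e₀ := by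
    intro x hx hxE
    rcases adj_cases hx with rfl | rfl | rfl | rfl
    · exact (h₀ ⟨_, hxE, Sym2.mem_mk_right _ _⟩).elim
    · rfl
    · rcases hv with rfl | rfl
      · exact (hcon hxE).elim
      · exact (h₁ ⟨_, hxE, by rw [sub_neg_eq_add]; exact Sym2.mem_mk_right _ _⟩).elim
    · rcases hv with rfl | rfl
      · exact (h₁ ⟨_, hxE, Sym2.mem_mk_right _ _⟩).elim
      · exact (hcon (by rw [← sub_eq_add_neg]; exact hxE)).elim
  obtain ⟨e, he, hqe⟩ := hq
  rw [← Sym2.other_spec hqe] at he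
  obtain ⟨r, hrp, hr, hrE⟩ := exists_snd_edge hE he
  exact hrp ((key r hr hrE).trans (key _ (adj_of_mem_polygon hE he) he).symm)

/-! ## The generic surgery lemma -/

/-- GENERIC MADRAS CASE. Let `c` be the case of the polygon `E` at `Y`, whose right corridor is
vertex-free, and suppose the case tables read: removed edge `{pt Y d, pt Y b}` (an edge of `E`),
added path an explicit nine-edge lattice walk `P` through the sites `d :: l` (pairwise distinct,
from `d` to `b`, in the columns `≤ 2`), fresh cells `l.dropLast`, with the interior sites not vertices of `E` (plus the decidable
combinatorics of the list: interior sites are fresh cells, every site is on a path edge, no path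
edge joins the two ends, and the output 2-segment consists of path edges). Then `modify E Y` is a
polygon with `#E + 8` edges containing the output vertical 2-segment in column `Y 0 + 2`, its
vertices in the window rows have abscissa `≤ Y 0 + 2`, its vertices are old vertices or fresh
cells, old vertices survive, and `unmodify c` undoes it. [folklore] -/
private theorem modify_spec_of_path {E : Finset (Sym2 (Site 2))} {Y : Site 2} {c : JCase}
    (d b : ℤ × ℤ) (l : List (ℤ × ℤ)) (P : (zdGraph 2).Walk (pt Y d) (pt Y b))
    (hPs : P.support = (d :: l).map (pt Y))
    (hPe : P.edges = ((d :: l).zip l).map fun p => s(pt Y p.1, pt Y p.2)) (hPl : P.length = 9)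
    (hl : (d :: l).Nodup ∧ b ∈ d :: l)
    (hsite : ∀ u ∈ d :: l, u.1 ≤ 2 ∧ (u ≠ d → u ≠ b → u ∈ l.dropLast))
    (honto : ∀ u ∈ d :: l, ∃ x ∈ (d :: l).zip l, u = x.1 ∨ u = x.2)
    (hends : (∀ x ∈ (d :: l).zip l, ¬ ((x.1 = d ∨ x.1 = b) ∧ (x.2 = d ∨ x.2 = b))) ∧
      (((2, -1), (2, 0)) ∈ (d :: l).zip l ∨ ((2, 0), (2, -1)) ∈ (d :: l).zip l) ∧
      (((2, 0), (2, 1)) ∈ (d :: l).zip l ∨ ((2, 1), (2, 0)) ∈ (d :: l).zip l))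
    (hE : IsPolygon (zdGraph 2) E) (hc : caseOf E Y = c)
    (hcorr : ∀ s t : ℤ, 1 ≤ s → -1 ≤ t → t ≤ 1 → ¬ IsV E (Y + ![s, t]))
    (hR : removedE c Y = {s(pt Y d, pt Y b)})
    (hA : addedE c Y = (((d :: l).zip l).map fun p => s(pt Y p.1, pt Y p.2)).toFinset)
    (hm : newCells c Y = (l.dropLast.map (pt Y)).toFinset)
    (hab : s(pt Y d, pt Y b) ∈ E) (hfresh : ∀ u ∈ d :: l, u ≠ d → u ≠ b → ¬ IsV E (pt Y u)) :
    IsPolygon (zdGraph 2) (modify E Y) ∧ (modify E Y).card = E.card + 8 ∧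
      s(pt Y (2, -1), pt Y (2, 0)) ∈ modify E Y ∧ s(pt Y (2, 0), pt Y (2, 1)) ∈ modify E Y ∧
      (∀ p : Site 2, IsV (modify E Y) p → -1 ≤ p 1 - Y 1 → p 1 - Y 1 ≤ 1 → p 0 ≤ Y 0 + 2) ∧
      (∀ p : Site 2, IsV (modify E Y) p → IsV E p ∨ p ∈ newCells c Y) ∧
      (∀ p : Site 2, IsV E p → IsV (modify E Y) p) ∧ unmodify c (modify E Y) Y = E := by
  obtain ⟨hnd, hbl⟩ := hl
  obtain ⟨hends, h21, h22⟩ := hends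
  -- the edge-replacement lemma
  have hpath : P.IsPath := Walk.IsPath.mk' (by rw [hPs]; exact hnd.map (pt_injective Y))
  obtain ⟨hpoly, hcard⟩ := isPolygon_replace_edge E _ _ P hE hab hpath (by omega) (by
      intro x hx h1 h2
      rw [hPs, List.mem_map] at hx
      obtain ⟨u, hu, rfl⟩ := hx
      exact hfresh u hu (fun h => h1 (by rw [h])) (fun h => h2 (by rw [h])))
  rw [hPl] at hcard
  have hmod : modify E Y = E.erase s(pt Y d, pt Y b) ∪ P.edges.toFinset := by
    rw [modify, hc, hR, hA, Finset.sdiff_singleton_eq_erase, hPe]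
  -- vertices of the modification: old vertices or path sites
  have hverts : ∀ p, IsV (modify E Y) p → IsV E p ∨ ∃ u ∈ d :: l, p = pt Y u := by
    rintro p ⟨e, he, hpe⟩
    rw [hmod, Finset.mem_union, Finset.mem_erase, List.mem_toFinset, hPe, List.mem_map] at he
    rcases he with ⟨-, heE⟩ | ⟨⟨x1, x2⟩, hx, rfl⟩
    · exact Or.inl ⟨e, heE, hpe⟩
    · obtain ⟨hx1, hx2⟩ := List.of_mem_zip hx
      rcases Sym2.mem_iff.1 hpe with rfl | rfl
      · exact Or.inr ⟨x1, hx1, rfl⟩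
      · exact Or.inr ⟨x2, List.mem_cons_of_mem _ hx2, rfl⟩
  -- the two ends of the path are old vertices; an old vertex on the path is an end
  have hdV : IsV E (pt Y d) := ⟨_, hab, Sym2.mem_mk_left _ _⟩
  have hbV : IsV E (pt Y b) := ⟨_, hab, Sym2.mem_mk_right _ _⟩
  have hend : ∀ u ∈ d :: l, IsV E (pt Y u) → u = d ∨ u = b := by
    intro u hu huV
    by_cases h1 : u = d
    · exact Or.inl h1
    by_cases h2 : u = b
    · exact Or.inr h2
    exact (hfresh u hu h1 h2 huV).elim
  -- no path edge is an old edge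
  have hAE : ∀ x ∈ (d :: l).zip l, s(pt Y x.1, pt Y x.2) ∉ E := by
    rintro ⟨x1, x2⟩ hx hxE
    obtain ⟨hx1, hx2⟩ := List.of_mem_zip hx
    exact hends _ hx ⟨hend x1 hx1 ⟨_, hxE, Sym2.mem_mk_left _ _⟩,
      hend x2 (List.mem_cons_of_mem _ hx2) ⟨_, hxE, Sym2.mem_mk_right _ _⟩⟩
  -- path edges are edges of the modification; every path site lies on one
  have hseg : ∀ a b : ℤ × ℤ, (a, b) ∈ (d :: l).zip l ∨ (b, a) ∈ (d :: l).zip l →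
      s(pt Y a, pt Y b) ∈ modify E Y := by
    intro a b h
    rw [hmod, Finset.mem_union, List.mem_toFinset, hPe, List.mem_map]
    rcases h with h | h
    · exact Or.inr ⟨_, h, rfl⟩
    · exact Or.inr ⟨_, h, Sym2.eq_swap⟩
  have hon : ∀ u ∈ d :: l, IsV (modify E Y) (pt Y u) := by
    intro u hu
    obtain ⟨x, hx, hux⟩ := honto u hu
    refine ⟨_, hseg x.1 x.2 (Or.inl hx), ?_⟩
    rcases hux with rfl | rfl
    · exact Sym2.mem_mk_left _ _
    · exact Sym2.mem_mk_right _ _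
  refine ⟨hmod ▸ hpoly, by rw [hmod]; omega, hseg _ _ h21, hseg _ _ h22, ?_, ?_, ?_, ?_⟩
  · intro p hp ht1 ht2
    rcases hverts p hp with h | ⟨u, hu, rfl⟩
    · by_contra hlt
      refine hcorr (p 0 - Y 0) (p 1 - Y 1) (by omega) ht1 ht2 ?_
      rw [Y_add_offset]; exact h
    · have := pt_apply_zero Y u; have := (hsite u hu).1; omega
  · intro p hp
    rcases hverts p hp with h | ⟨u, hu, rfl⟩
    · exact Or.inl h
    · by_cases huV : IsV E (pt Y u)
      · exact Or.inl huV
      · refine Or.inr ?_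
        rw [hm, List.mem_toFinset, List.mem_map]
        exact ⟨u, (hsite u hu).2 (fun h => huV (h ▸ hdV)) (fun h => huV (h ▸ hbV)), rfl⟩
  · rintro p ⟨e, he, hpe⟩
    by_cases hne : e = s(pt Y d, pt Y b)
    · subst hne
      rcases Sym2.mem_iff.1 hpe with rfl | rfl
      · exact hon d List.mem_cons_self
      · exact hon _ hbl
    · exact ⟨e, by rw [hmod]; exact Finset.mem_union_left _ (Finset.mem_erase.2 ⟨hne, he⟩), hpe⟩
  · rw [unmodify, hA, ← hPe, hR, hmod]
    ext e
    simp only [Finset.mem_union, Finset.mem_sdiff, Finset.mem_erase, Finset.mem_singleton]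
    constructor
    · rintro (⟨⟨-, he⟩ | he, hne⟩ | rfl)
      · exact he
      · exact (hne he).elim
      · exact hab
    · intro he
      by_cases hne : e = s(pt Y d, pt Y b)
      · exact Or.inr hne
      · refine Or.inl ⟨Or.inl ⟨hne, he⟩, fun heA => ?_⟩
        rw [List.mem_toFinset, hPe, List.mem_map] at heA
        obtain ⟨x, hx, rfl⟩ := heA
        exact hAE x hx he

/-! ## The two registered cases -/

/-- **Case `B1` of Madras' modification.** If `E` is a polygon in case `B1` at `Y` (`Y` not a
vertex, `Y + e₁` a vertex, the cell `Y + (1, 2)` free) whose right corridor is vertex-free, then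
`modify E Y` (the corner edge `{Y + e₁, Y + 2e₁}` replaced by the nine-edge path through `Y`, the
corridor and `Y + (1, 2)`) is a polygon with `#E + 8` edges carrying the vertical 2-segment in
column `Y 0 + 2` across the window rows, with the listed vertex bookkeeping, and `unmodify B1`
recovers `E`. [cite: Hammond2015SAPJoining, §4.1 (Madras' modification)] -/
theorem modify_spec_B1 : ∀ (E : Finset (Sym2 (Site 2))) (Y : Site 2), IsPolygon (zdGraph 2) E → caseOf E Y = JCase.B1 → (∀ s t : ℤ, 1 ≤ s → -1 ≤ t → t ≤ 1 → ¬ IsV E (Y + ![s, t])) → IsPolygon (zdGraph 2) (modify E Y) ∧ (modify E Y).card = E.card + 8 ∧ s(pt Y (2, -1), pt Y (2, 0)) ∈ modify E Y ∧ s(pt Y (2, 0), pt Y (2, 1)) ∈ modify E Y ∧ (∀ p : Site 2, IsV (modify E Y) p → -1 ≤ p 1 - Y 1 → p 1 - Y 1 ≤ 1 → p 0 ≤ Y 0 + 2) ∧ (∀ p : Site 2, IsV (modify E Y) p → IsV E p ∨ p ∈ newCells JCase.B1 Y) ∧ (∀ p : Site 2, IsV E p → IsV (modify E Y) p) ∧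 unmodify JCase.B1 (modify E Y) Y = E := by
  intro E Y hE hc hcorr
  -- the case facts
  obtain ⟨hY0, hY1, hY12⟩ : ¬ IsV E Y ∧ IsV E (Y + e₁) ∧ ¬ IsV E (pt Y (1, 2)) := by
    have h := hc
    unfold caseOf at h
    split_ifs at h
    exact ⟨by assumption, by assumption, by assumption⟩
  -- the corner edge `{Y + e₁, Y + 2 e₁}` is an edge of `E` (`Y + e₁ = pt Y (0, 1)` by `rfl`)
  have h4 := e₀_e₁_apply
  have hab : s(pt Y (0, 1), pt Y (0, 2)) ∈ E := by
    rw [pt_eq_add (Y := Y) (0, 1) (0, 2) (v := e₁) (by omega) (by omega)]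
    refine mem_of_corner hE (Or.inl rfl) hY1 (fun h => ?_)
      (by change ¬ IsV E (Y + e₁ - e₁); rw [add_sub_cancel_right]; exact hY0)
    rw [← pt_eq_add (Y := Y) (0, 1) (1, 1) (v := e₀) (by omega) (by omega)] at h
    exact hcorr 1 1 le_rfl (by norm_num) le_rfl h
  refine modify_spec_of_path (0, 1) (0, 2)
    [(0, 0), (1, 0), (1, -1), (2, -1), (2, 0), (2, 1), (1, 1), (1, 2), (0, 2)]
    (.cons (adj_pt Y (0, 1) (0, 0)) <| .cons (adj_pt Y (0, 0) (1, 0)) <|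
      .cons (adj_pt Y (1, 0) (1, -1)) <| .cons (adj_pt Y (1, -1) (2, -1)) <|
      .cons (adj_pt Y (2, -1) (2, 0)) <| .cons (adj_pt Y (2, 0) (2, 1)) <|
      .cons (adj_pt Y (2, 1) (1, 1)) <| .cons (adj_pt Y (1, 1) (1, 2)) <|
      .cons (adj_pt Y (1, 2) (0, 2)) .nil)
    rfl rfl rfl (by decide) (by decide) (by decide) (by decide) hE hc hcorr
    (by simp [removedE, remPairs]) rfl rfl hab ?_
  -- the interior sites are fresh
  intro u hu h1 h2
  simp only [List.mem_cons, List.not_mem_nil, or_false] at hu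
  rcases hu with rfl | rfl | rfl | rfl | rfl | rfl | rfl | rfl | rfl | rfl
  all_goals first
    | exact absurd rfl h1
    | exact absurd rfl h2
    | exact hY12
    | (rw [pt_zero]; exact hY0)
    | exact hcorr _ _ (by norm_num) (by norm_num) (by norm_num)

/-- **Case `C1` of Madras' modification** (mirror image of `B1` in the row of `Y`). If `E` is a
polygon in case `C1` at `Y` (`Y`, `Y + e₁` not vertices, the cell `Y + (1, -2)` free) with `Y - e₁`
a vertex and a vertex-free right corridor, then `modify E Y` (the corner edge `{Y - e₁, Y - 2e₁}`
replaced by the nine-edge path through `Y`, the corridor and `Y + (1, -2)`) is a polygon with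
`#E + 8` edges carrying the vertical 2-segment in column `Y 0 + 2` across the window rows, with the
listed vertex bookkeeping, and `unmodify C1` recovers `E`.
[cite: Hammond2015SAPJoining, §4.1 (Madras' modification)] -/
theorem modify_spec_C1 : ∀ (E : Finset (Sym2 (Site 2))) (Y : Site 2), IsPolygon (zdGraph 2) E → caseOf E Y = JCase.C1 → IsV E (Y - e₁) → (∀ s t : ℤ, 1 ≤ s → -1 ≤ t → t ≤ 1 → ¬ IsV E (Y + ![s, t])) → IsPolygon (zdGraph 2) (modify E Y) ∧ (modify E Y).card = E.card + 8 ∧ s(pt Y (2, -1), pt Y (2, 0)) ∈ modify E Y ∧ s(pt Y (2, 0), pt Y (2, 1)) ∈ modify E Y ∧ (∀ p : Site 2, IsV (modify E Y) p → -1 ≤ p 1 - Y 1 → p 1 - Y 1 ≤ 1 → p 0 ≤ Y 0 + 2) ∧ (∀ p : Site 2, IsV (modify E Y) p → IsV E p ∨ p ∈ newCells JCase.C1 Y) ∧ (∀ p : Site 2, IsV E p → IsV (modify E Y) p) ∧ unmodify JCase.C1 (modify E Y) Y = E := by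
  intro E Y hE hc hYm hcorr
  -- the case facts
  obtain ⟨hY0, hY12⟩ : ¬ IsV E Y ∧ ¬ IsV E (pt Y (1, -2)) := by
    have h := hc
    unfold caseOf at h
    split_ifs at h
    exact ⟨by assumption, by assumption⟩
  -- the corner `Y - e₁ = pt Y (0, -1)` and its edge `{Y - e₁, Y - 2 e₁}`
  have h4 := e₀_e₁_apply
  have hq : Y - e₁ = pt Y (0, -1) := by
    rw [site_eq_iff]; simp only [Pi.sub_apply, pt_apply_zero, pt_apply_one]; omega
  rw [hq] at hYm
  have hab : s(pt Y (0, -1), pt Y (0, -2)) ∈ E := by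
    have e2 : pt Y (0, -2) = pt Y (0, -1) + -e₁ :=
      pt_eq_add (0, -1) (0, -2) (by rw [Pi.neg_apply]; omega) (by rw [Pi.neg_apply]; omega)
    rw [e2]
    refine mem_of_corner hE (Or.inr rfl) hYm (fun h => ?_) ?_
    · rw [← pt_eq_add (Y := Y) (0, -1) (1, -1) (v := e₀) (by omega) (by omega)] at h
      exact hcorr 1 (-1) le_rfl le_rfl (by norm_num) h
    · rw [sub_neg_eq_add, ← pt_eq_add (Y := Y) (0, -1) (0, 0) (v := e₁) (by omega) (by omega),
        pt_zero]
      exact hY0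
  refine modify_spec_of_path (0, -1) (0, -2)
    [(0, 0), (1, 0), (1, 1), (2, 1), (2, 0), (2, -1), (1, -1), (1, -2), (0, -2)]
    (.cons (adj_pt Y (0, -1) (0, 0)) <| .cons (adj_pt Y (0, 0) (1, 0)) <|
      .cons (adj_pt Y (1, 0) (1, 1)) <| .cons (adj_pt Y (1, 1) (2, 1)) <|
      .cons (adj_pt Y (2, 1) (2, 0)) <| .cons (adj_pt Y (2, 0) (2, -1)) <|
      .cons (adj_pt Y (2, -1) (1, -1)) <| .cons (adj_pt Y (1, -1) (1, -2)) <|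
      .cons (adj_pt Y (1, -2) (0, -2)) .nil)
    rfl rfl rfl (by decide) (by decide) (by decide) (by decide) hE hc hcorr
    (by rw [Sym2.eq_swap]; simp [removedE, remPairs]) rfl rfl hab ?_
  -- the interior sites are fresh
  intro u hu h1 h2
  simp only [List.mem_cons, List.not_mem_nil, or_false] at hu
  rcases hu with rfl | rfl | rfl | rfl | rfl | rfl | rfl | rfl | rfl | rfl
  all_goals first
    | exact absurd rfl h1
    | exact absurd rfl h2
    | exact hY12
    | (rw [pt_zero]; exact hY0)
    | exact hcorr _ _ (by norm_num) (by norm_num) (by norm_num)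

end Summit.CriticalPhenomena.SAWScalingLimit.Theorems.CriticalBubbleBound.Join

end
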